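import Summits.BirchSwinnertonDyer.Rank1Residual.F1Sign2.MinusHalfSumParityAtTwoProofs
import HarnessLib

/-!
# Cell `bsd-f1-sign2`, AN-33 PROOFS (§6): the closed form of the minus half-sums `F_m mod 2u` over square-free odd levels — KERNEL-CHECKED (-an g16, Sketch_v27/v28 §6; TURNKEY D-an-77 step 2)

TYPER FILING (cell `bsd-f1-sign2`, seat `-ty` g11; plan `MEMO-ty-data/g10/AN33j_PLAN.md` step 2 = `MEMO-an-data/g16/turnkey/AN33k_PLAN.md`
7f0f7c3baffbdbe1 step 2): §6 of `MEMO-an-data/g16/Sketch_v28.lean` d50ca18231cd831c (lines 679–798; = §6 of `Sketch_v27.lean` 1f6effa7be7bca73,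
-an: farm rc 0 · 0 err · 0 warn · 0 sorry; REF1 §122/§123: standard axioms, no objection) VERBATIM, in the namespace of the statement file
`F1Sign2/MinusHalfSumParityAtTwo.lean` and importing the AN-33b/c proofs `F1Sign2/MinusHalfSumParityAtTwoProofs.lean` (p646548:
`minusHalfSumHeckeStepModTwo_holds`, `minusHalfSumProportionalityModTwo_holds`).  ONE theorem: **`minusHalfSum_closedForm_modTwo`** — for a rational
newform `f`, a symbol unit `u`, a `3`-cycle prime `q₀ ∤ N` (`a_{q₀}` odd) and a square-free odd `m` with all prime factors `∤ N`:
`F_m ≡ F_{q₀} (mod 2u)` if some prime factor `q ∣ m` has `a_q` odd, `F_m ≡ 0 (mod 2u)` if all `a_q` are even (AN-33b iterated along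
`Nat.recOnMul` + AN-33c at the primes).  Used by the sibling `F1Sign2/MinusHalfSumPureCycleProofs.lean` (§7, AN-33j).  Typer edits = this header and
the imports; proof verbatim.  Placement (REF2 v33 §1 / v34 §1): IN-PRINT-ASSEMBLY (Mazur–Tate 1987 §1 norm relation read mod `2u` on the minus side;
Zhai 2016 Lemmas 2.2–2.3 induction on the number of prime factors); kernel-checked; beyond-print no.  Nothing here proves BSD; 23715 not closed.
[cite: MazurTate1987, §1] [cite: Zhai2016, Lemmas 2.2–2.3]
-/

set_option autoImplicit false

noncomputable section

open scoped MatrixGroups ModularForm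

open CongruenceSubgroup Literature.NumberTheory.EllipticCurves Literature.NumberTheory.EllipticCurves.ModularForms

namespace Summit.BirchSwinnertonDyer.Rank1Residual.F1Sign2.ANg16

/-! ### §6 PROOFS (v27): the closed form of `F_m mod 2u` over square-free odd levels (AN-33b iterated along the prime factorisation + AN-33c). -/

section ClosedForm

variable {N : ℕ} [NeZero N] (f : CuspForm (Gamma0 N) 2)

/-- **Closed form of the minus half-sums mod `2u` (symbol half of AN-33f, PROVED).**  Let `f` be a newform with rational
coefficients, `u` a symbol unit, and `q₀ ∤ N` an odd prime with `a_{q₀}` odd (a "`3`-cycle prime").  For every square-free odd `m`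
all of whose prime factors `q` satisfy `q ∤ N` (with `a_q(f) = a q`):
`F_m ≡ F_{q₀} (mod 2u)` if some prime factor of `m` has `a_q` odd, and `F_m ≡ 0 (mod 2u)` if all have `a_q` even. -/
theorem minusHalfSum_closedForm_modTwo (hf : IsNewform0 f) (hQ : coeffField f = ⊥) {u : ℚ} (hu : IsMinusSymbolUnit f u)
    {q₀ : ℕ} (hq₀ : q₀.Prime) (hq₀o : Odd q₀) (hq₀N : ¬ q₀ ∣ N) {a₀ : ℤ} (ha₀ : cuspCoeff f q₀ = (a₀ : ℂ)) (ha₀o : Odd a₀)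
    (a : ℕ → ℤ) (m : ℕ) (hsq : Squarefree m) (hmo : Odd m)
    (hpr : ∀ q ∈ m.primeFactors, ¬ q ∣ N ∧ cuspCoeff f q = (a q : ℂ)) :
    ((∃ q ∈ m.primeFactors, Odd (a q)) → ∃ z : ℤ, minusHalfSum f m = minusHalfSum f q₀ + 2 * z * u) ∧
    ((∀ q ∈ m.primeFactors, Even (a q)) → ∃ z : ℤ, minusHalfSum f m = 2 * z * u) := by
  obtain ⟨b₀, hb₀⟩ := ha₀o
  obtain ⟨y, hy⟩ := exists_int_minusHalfSum_eq_mul hu q₀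
  have hb₀Q : ((a₀ : ℤ) : ℚ) = 2 * (b₀ : ℚ) + 1 := by exact_mod_cast hb₀
  -- the value at a single prime `q ∤ N`: `F_q ≡ F_{q₀}` if `a_q` odd, `F_q ≡ 0` if `a_q` even
  have hprime : ∀ q : ℕ, q.Prime → Odd q → ¬ q ∣ N → cuspCoeff f q = (a q : ℂ) →
      (Odd (a q) → ∃ z : ℤ, minusHalfSum f q = minusHalfSum f q₀ + 2 * z * u) ∧
      (Even (a q) → ∃ z : ℤ, minusHalfSum f q = 2 * z * u) := by
    intro q hq hqo hqN haq
    obtain ⟨xq, hxq⟩ := exists_int_minusHalfSum_eq_mul hu q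
    by_cases hqq : q = q₀
    · subst hqq
      have haa : a q = a₀ := by
        have : ((a q : ℤ) : ℂ) = (a₀ : ℂ) := by rw [← haq, ha₀]
        exact_mod_cast this
      refine ⟨fun _ => ⟨0, by ring⟩, fun hev => ?_⟩
      exfalso
      obtain ⟨b, hb⟩ := hev
      omega
    obtain ⟨z₁, hz₁⟩ := minusHalfSumProportionalityModTwo_holds N f hf hQ u hu q q₀ hq hq₀ hqo hq₀o hqq hqN hq₀N
      (a q) a₀ haq ha₀
    refine ⟨fun hod => ?_, fun hev => ?_⟩
    · obtain ⟨b, hb⟩ := hod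
      have hbQ : ((a q : ℤ) : ℚ) = 2 * (b : ℚ) + 1 := by exact_mod_cast hb
      refine ⟨z₁ - b₀ * xq + b * y, ?_⟩
      rw [hbQ, hb₀Q] at hz₁
      rw [hxq, hy] at hz₁ ⊢
      push_cast
      linear_combination hz₁
    · obtain ⟨b, hb⟩ := hev
      have hbQ : ((a q : ℤ) : ℚ) = (b : ℚ) + b := by exact_mod_cast hb
      refine ⟨z₁ + b * y - b₀ * xq, ?_⟩
      rw [hbQ, hb₀Q] at hz₁
      rw [hxq, hy] at hz₁
      rw [hxq]
      push_cast
      linear_combination hz₁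
  -- strong induction on `m`
  induction m using Nat.strong_induction_on with
  | _ m ih =>
    by_cases hm1 : m = 1
    · subst hm1
      refine ⟨fun ⟨q, hq, _⟩ => by simp at hq, fun _ => ⟨0, ?_⟩⟩
      simp [minusHalfSum]
    have hm0 : m ≠ 0 := by rintro rfl; exact absurd hmo (by decide)
    set q := m.minFac with hq_def
    have hq : q.Prime := Nat.minFac_prime hm1
    have hqm : q ∣ m := Nat.minFac_dvd m
    set m' := m / q with hm'_def
    have hmm' : m = q * m' := (Nat.mul_div_cancel' hqm).symm
    have hm'0 : m' ≠ 0 := by intro h; rw [h, mul_zero] at hmm'; exact hm0 hmm'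
    have hqo : Odd q := hmo.of_dvd_nat hqm
    have hm'dvd : m' ∣ m := Nat.div_dvd_of_dvd hqm
    have hm'o : Odd m' := hmo.of_dvd_nat hm'dvd
    have hsq' : Squarefree m' := hsq.squarefree_of_dvd hm'dvd
    have hcop : Nat.Coprime q m' := Nat.coprime_of_squarefree_mul (hmm' ▸ hsq)
    have hqm' : ¬ q ∣ m' := (Nat.Prime.coprime_iff_not_dvd hq).1 hcop
    have hlt : m' < m := by
      rw [hm'_def]; exact Nat.div_lt_self (Nat.pos_of_ne_zero hm0) hq.one_lt
    have hqmem : q ∈ m.primeFactors := Nat.mem_primeFactors.2 ⟨hq, hqm, hm0⟩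
    have hsub : ∀ q' ∈ m'.primeFactors, q' ∈ m.primeFactors := fun q' hq' => Nat.primeFactors_mono hm'dvd hm0 hq'
    have hsplit : ∀ q' ∈ m.primeFactors, q' = q ∨ q' ∈ m'.primeFactors := by
      intro q' hq'
      rw [hmm', Nat.primeFactors_mul hq.ne_zero hm'0, Finset.mem_union, hq.primeFactors, Finset.mem_singleton] at hq'
      exact hq'
    have ih' := ih m' hlt hsq' hm'o (fun q' hq' => hpr q' (hsub q' hq'))
    obtain ⟨z, hz⟩ := minusHalfSumHeckeStep f hf hQ hu hm'o hq hqo (hpr q hqmem).1 hqm' (hpr q hqmem).2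
    rw [← hmm'] at hz
    obtain ⟨x', hx'⟩ := exists_int_minusHalfSum_eq_mul hu m'
    have hPq := hprime q hq hqo (hpr q hqmem).1 (hpr q hqmem).2
    rcases Int.even_or_odd (a q) with hev | hod
    · -- `a_q` even: `F_m ≡ F_{m'} + F_q ≡ F_{m'}`
      obtain ⟨zq, hzq⟩ := hPq.2 hev
      obtain ⟨b, hb⟩ := hev
      have hbQ : ((a q : ℤ) : ℚ) = (b : ℚ) + b := by exact_mod_cast hb
      rw [hbQ, hzq] at hz
      refine ⟨fun ⟨q', hq', hq'o⟩ => ?_, fun hall => ?_⟩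
      · have hq'm' : q' ∈ m'.primeFactors := by
          rcases hsplit q' hq' with h | h
          · exfalso; subst h; rw [hb] at hq'o; exact (Int.not_odd_iff_even.2 ⟨b, rfl⟩) hq'o
          · exact h
        obtain ⟨z', hz'⟩ := ih'.1 ⟨q', hq'm', hq'o⟩
        refine ⟨z + zq + (b + b - 1) * z' + (b - 1) * y + 0, ?_⟩
        rw [hz', hy] at hz
        rw [hy]
        push_cast
        linear_combination hz
      · obtain ⟨z', hz'⟩ := ih'.2 (fun q' hq' => hall q' (hsub q' hq'))
        refine ⟨z + zq + (b + b - 1) * z', ?_⟩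
        rw [hz'] at hz
        push_cast
        linear_combination hz
    · -- `a_q` odd: `F_m ≡ F_q ≡ F_{q₀}`
      obtain ⟨zq, hzq⟩ := hPq.1 hod
      obtain ⟨b, hb⟩ := hod
      have hbQ : ((a q : ℤ) : ℚ) = 2 * (b : ℚ) + 1 := by exact_mod_cast hb
      rw [hbQ, hzq, hx'] at hz
      refine ⟨fun _ => ⟨z + zq + b * x', ?_⟩, fun hall => ?_⟩
      · push_cast
        linear_combination hz
      · exfalso
        obtain ⟨c, hc⟩ := hall q hqmem
        omega

end ClosedForm

end Summit.BirchSwinnertonDyer.Rank1Residual.F1Sign2.ANg16
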